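import Literature.AnabelianGeometry.AbsoluteAnabelian.AbsTopIII.LogObservableLevels
import HarnessLib

/-!
# [AbsTopIII] Corollary 3.6 (iii), proof: the boundary set `E_log` in the holomorphic orientation

Mochizuki, *Topics in Absolute Anabelian Geometry III*, proof of Corollary 3.6 (iii), p.81 (bib key
`MochizukiAbsTopIII2015`; lit key `paper:url-5493eb38cbb7`): "if one takes `E_log` to be the set of
ordered pairs of paths on `Γ⃗_{𝒟≤3}` (i.e., the underlying oriented graph of `𝒟_{≤3}`) consisting of
pairs of paths of the following three types: (1) `([λ^×]∘[id_⋎]∘[log]∘[γ], [λ^{×pf}]∘[id_{⋎+1}]∘[γ])`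
…; (2) `([λ^×]∘[γ], [λ^{×pf}]∘[γ])` …; (3) `([γ], [γ])` …  Then one verifies immediately that
`E_log` satisfies the conditions (a), (b), (c), (d), (e) given in §0 for a saturated set".
This file: the two path surgeries `swapLast` (type (2)) and `hlower` (type (1), the `λ^×` branch of
`lower` of `LogObservablePaths.lean`), the boundary set `HLogRel` and its saturation
(`isSaturated_hLogRel`) — orientation bookkeeping only, no functors.  The homotopies and the
statement `observableLogStmt_of_inl` are in `HolLogFrobeniusObservable.lean` (seat abc-iut-L4-t10,
coordination with abc-iut-L4-t5: STATUS 20:14:06Z / 20:27Z).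
-/

namespace Literature.AnabelianGeometry.AbsoluteAnabelian.AbsTopIII

open _root_.CategoryTheory _root_.Quiver LogFrobeniusData

universe u

/-! ### The two surgeries: `[λ^×]∘γ ↦ [λ^{×pf}]∘γ` (type (2)) and the type-(1) lowering -/

/-- Type (2) surgery, last-edge layer: a final `λ^×` becomes `λ^{×pf}`.
[cite: MochizukiAbsTopIII2015, Corollary 3.6 (iii) p.81] -/
def swapLastAux {a : V3.{u}} : ∀ (x y : V3.{u}) (_p : Path a x) (_e : x ⟶ y), Path a y
  | .base ⟨.nexus, h⟩, .obs, p, ⟨true⟩ => p.cons (ePfAt h)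
  | _, _, p, e => p.cons e

/-- Type (2) surgery `[λ^×]∘γ ↦ [λ^{×pf}]∘γ` (identity on other paths).
[cite: MochizukiAbsTopIII2015, Corollary 3.6 (iii) p.81] -/
def swapLast {a : V3.{u}} : ∀ {b : V3.{u}}, Path a b → Path a b
  | _, .nil => .nil
  | _, .cons (b := x) (c := y) p e => swapLastAux x y p e

/-- Type (1) surgery, last-edge layer: `[λ^×]∘[id_n]∘[log]∘γ ↦ [λ^{×pf}]∘[id_{n+1}]∘γ` (the `λ^×`
branch of `lower`; bottom paths fixed; identity on other paths).
[cite: MochizukiAbsTopIII2015, Corollary 3.6 (iii) p.81] -/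
def hlowerLast {a : V3.{u}} : ∀ (x y : V3.{u}) (_p : Path a x) (_e : x ⟶ y), Path a y
  | .base ⟨.nexus, h⟩, .obs, p, ⟨true⟩ => lowerTimes h p
  | _, _, p, e => p.cons e

/-- Type (1) surgery on paths (identity unless the path is `[λ^×]∘[id_n]∘[log]∘γ`).
[cite: MochizukiAbsTopIII2015, Corollary 3.6 (iii) p.81] -/
def hlower {a : V3.{u}} : ∀ {b : V3.{u}}, Path a b → Path a b
  | _, .nil => .nil
  | _, .cons (b := x) (c := y) p e => hlowerLast x y p e

/-- Computation rule. [cite: MochizukiAbsTopIII2015, Corollary 3.6 (iii) p.81] -/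
theorem swapLast_cons_lamTimes {a : V3.{u}} (p₀ : Path a lvNexus.{u}) :
    swapLast (p₀.cons eLamTimes) = p₀.cons eLamPf := rfl

/-- Computation rule. [cite: MochizukiAbsTopIII2015, Corollary 3.6 (iii) p.81] -/
theorem hlower_cons_lamTimes {a : V3.{u}} (p₀ : Path a lvNexus.{u}) :
    hlower (p₀.cons eLamTimes) = lower (p₀.cons eLamTimes) := rfl

/-- A path into `𝒩` ending with `λ^×` is `[λ^×]∘γ`. [cite: MochizukiAbsTopIII2015, Corollary 3.6
p.78] -/
theorem exists_eq_cons_lamTimes {a : V3.{u}} (p : Path a lvObs.{u}) (ha : a ≠ lvObs.{u})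
    (hp : lastTimes p = true) : ∃ p₀ : Path a lvNexus.{u}, p = p₀.cons eLamTimes := by
  cases p with
  | nil => exact absurd rfl ha
  | cons p₀ e =>
    obtain rfl := eq_nexus_of_hom_obs e
    rcases hom_obs_eq e with rfl | rfl
    · exact ⟨p₀, rfl⟩
    · exact absurd hp (by show ¬ false = true; decide)

/-- `swapLast` flips the last edge and keeps the `log`s.
[cite: MochizukiAbsTopIII2015, Corollary 3.6 (iii) p.81] -/
theorem swapLast_spec {a : V3.{u}} (p : Path a lvObs.{u}) (ha : a ≠ lvObs.{u}) (hp : lastTimes p = true) :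
    lastTimes (swapLast p) = false ∧ nlogs (swapLast p) = nlogs p := by
  obtain ⟨p₀, rfl⟩ := exists_eq_cons_lamTimes p ha hp
  exact ⟨rfl, rfl⟩

/-- `hlower` fixes the path or flips the last edge and removes one `log`.
[cite: MochizukiAbsTopIII2015, Corollary 3.6 (iii) p.81] -/
theorem hlower_spec {a : V3.{u}} (p : Path a lvObs.{u}) (ha : a ≠ lvObs.{u}) (hp : lastTimes p = true) :
    hlower p = p ∨ (lastTimes (hlower p) = false ∧ nlogs (hlower p) + 1 = nlogs p ∧
      ∃ (n : ℤ) (p₂ : Path a (lvRow1.{u} (n + 1))), p = ((p₂.cons (logE n)).cons (idE n)).cons eLamTimes) := by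
  obtain ⟨p₀, rfl⟩ := exists_eq_cons_lamTimes p ha hp
  cases p₀ with
  | nil => exact Or.inl rfl
  | cons p₁ e₁ =>
    obtain ⟨n, rfl⟩ := eq_row1_of_hom_nexus e₁
    obtain rfl : e₁ = idE n := rfl
    cases p₁ with
    | nil => exact Or.inl rfl
    | cons p₂ e₂ =>
      obtain rfl := eq_row1_of_hom_row1 e₂
      obtain rfl := hom_row1_eq e₂
      exact Or.inr ⟨rfl, rfl, n, p₂, rfl⟩

/-! ### The boundary set `E_log` (holomorphic orientation) -/

/-- **The boundary set `E_log` of `𝔖_log`, holomorphic orientation**: the reflexive pairs (3), the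
type-(2) pairs `(p, swapLast p)` and the type-(1) pairs `(p, hlower p)` (for `p` into `𝒩` out of a
vertex `≠ 𝒩`, ending with `λ^×`). [cite: MochizukiAbsTopIII2015, Corollary 3.6 (iii) p.81] -/
def HLogRel : ∀ ⦃a b : V3.{u}⦄, Path a b → Path a b → Prop :=
  fun a b p q => b = lvObs.{u} ∧ a ≠ lvObs.{u} ∧
    (q = p ∨ (lastTimes p = true ∧ (q = swapLast p ∨ q = hlower p)))

/-- A pair of `E_log` whose first member ends with `λ^{×pf}` is reflexive.
[cite: MochizukiAbsTopIII2015, Corollary 3.6 (iii) p.81] -/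
theorem HLogRel.eq_of_lastTimes_false {a b : V3.{u}} {p q : Path a b} (h : HLogRel p q)
    (hp : lastTimes p = false) : q = p := by
  rcases h.2.2 with rfl | ⟨hp', _⟩
  · rfl
  · rw [hp] at hp'; exact absurd hp' (by decide)

/-- "`E_log` satisfies the conditions (a)–(e) of §0 for a saturated set" (holomorphic orientation).
[cite: MochizukiAbsTopIII2015, Corollary 3.6 (iii) p.81] -/
theorem isSaturated_hLogRel : IsSaturated HLogRel.{u} where
  refl_left := fun _ _ _ _ h => ⟨h.1, h.2.1, Or.inl rfl⟩
  refl_right := fun _ _ _ _ h => ⟨h.1, h.2.1, Or.inl rfl⟩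
  trans := by
    rintro a b p q r ⟨rfl, ha, h₁⟩ ⟨_, _, h₂⟩
    refine ⟨rfl, ha, ?_⟩
    rcases h₁ with rfl | ⟨hp, rfl | rfl⟩
    · exact h₂
    · have hq := (swapLast_spec p ha hp).1
      rcases h₂ with rfl | ⟨hq', _⟩
      · exact Or.inr ⟨hp, Or.inl rfl⟩
      · rw [hq] at hq'; exact absurd hq' (by decide)
    · rcases hlower_spec p ha hp with hfix | ⟨hq, -, -⟩
      · rw [hfix] at h₂
        rcases h₂ with rfl | ⟨-, rfl | rfl⟩
        · exact Or.inl rfl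
        · exact Or.inr ⟨hp, Or.inl rfl⟩
        · exact Or.inr ⟨hp, Or.inr rfl⟩
      · rcases h₂ with rfl | ⟨hq', _⟩
        · exact Or.inr ⟨hp, Or.inr rfl⟩
        · rw [hq] at hq'; exact absurd hq' (by decide)
  precomp := by
    rintro a b c p q ⟨rfl, ha, h⟩ r
    have hc : c ≠ lvObs := by rintro rfl; exact ha (path_from_obs r)
    refine ⟨rfl, hc, ?_⟩
    rcases h with rfl | ⟨hp, rfl | rfl⟩
    · exact Or.inl rfl
    · obtain ⟨p₀, rfl⟩ := exists_eq_cons_lamTimes p ha hp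
      exact Or.inr ⟨rfl, Or.inl rfl⟩
    · rcases hlower_spec p ha hp with hfix | ⟨-, -, n, p₂, rfl⟩
      · rw [hfix]; exact Or.inl rfl
      · exact Or.inr ⟨rfl, Or.inr rfl⟩
  postcomp := by
    rintro a b c p q ⟨rfl, ha, h⟩ r
    obtain rfl := path_from_obs r
    obtain rfl := path_obs_obs_eq_nil r
    exact ⟨rfl, ha, h⟩


end Literature.AnabelianGeometry.AbsoluteAnabelian.AbsTopIII
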